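import Summits.ResolutionOfSingularities.ResolutionOfSingularities.Theorems.EquisingularLiftEquisingularLiftNatNDInvariants
import Literature.AlgebraicGeometry.Resolution.NormalCrossingsLocal
import Literature.AlgebraicGeometry.Resolution.MarkedIdealsEtale
import Literature.AlgebraicGeometry.Resolution.PointBlowupHsFunMono
import Literature.AlgebraicGeometry.Resolution.BlowupRestrictOpen
import HarnessLib

/-!
# [OURS · L1 W4.5(b) · EL♮(3)] (B4β′) `ND.ndInvPersists : ND.NDInvPersists n k` — persistence of the downstairs invariant `NDInv` through one round
# (desk R31 (β) DEAL «ND-K5», re-deal 2026-08-28T14:08:16Z: res-L1-w45b-lead-2 g6)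

OURS · counted 0 · AI-written, weaker than expert review; nothing of [Hironaka2017] asserted; NOT a statement of the manuscript. Def-free.
`--supports stmt-ResolutionOfSingularities-20148 --as helper` (brick of the ND rung `stub_elnat_three_isolated_newtonNondegenerate`).

CONTENT: bookkeeping only. Off the blown-up point `x` the round `β ≫ υ` is an isomorphism onto `{x}ᶜ`, so the other non-regular points of the reduced closure of
`T₁` and their local ND frame data move along it (stalk isomorphisms: `stalkIdeal_comap_eq_map`, `comap_vanishingIdeal_of_isOpenImmersion`,
`isRegularLocalRing_stalk_subscheme_iff`); over `x` the END clause says every point of the new reduced closure is regular. Hence `NDInv (m+1)` becomes `NDInv m`.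
-/

set_option linter.dupNamespace false

noncomputable section

open CategoryTheory CategoryTheory.Limits AlgebraicGeometry TopologicalSpace Topology
open MvPolynomial
open Literature.AlgebraicGeometry.Resolution
open AlgebraicGeometry.Scheme.IdealSheafData

namespace Summit.ResolutionOfSingularities.ResolutionOfSingularities.Cruxes.EquisingularLiftNat.Sections.ND

open Summit.ResolutionOfSingularities.ResolutionOfSingularities.Cruxes.EquisingularLiftNat.Sections

section Persist

variable {F₉ F₁ : Scheme.{0}} (f : F₉ ⟶ F₁) (x : F₁) (hx : IsClosed ({x} : Set F₁))

/-- Off the point: the stalk maps of a morphism that restricts to an isomorphism over `{x}ᶜ` are isomorphisms (the stalk maps of `f ∣_ U` and of `f`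
are isomorphic arrows, `morphismRestrictStalkMap`). [folklore] -/
theorem isIso_stalkMap_of_isIso_restrict_compl [IsIso (f ∣_ (⟨{x}ᶜ, hx.isOpen_compl⟩ : F₁.Opens))] (y : F₉) (hy : f y ≠ x) :
    IsIso (f.stalkMap y) := by
  -- adapted from Theorems/EquisingularLiftEquisingularLiftGoodAtOverIso.lean
  have hyU : f y ∈ (⟨{x}ᶜ, hx.isOpen_compl⟩ : F₁.Opens) := hy
  have h1 : IsIso ((f ∣_ (⟨{x}ᶜ, hx.isOpen_compl⟩ : F₁.Opens)).stalkMap ⟨y, hyU⟩) := inferInstance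
  have h2 := (Arrow.isIso_iff_isIso_of_isIso (morphismRestrictStalkMap f (⟨{x}ᶜ, hx.isOpen_compl⟩ : F₁.Opens) ⟨y, hyU⟩).hom).mp h1
  simpa using h2

/-- Off the point: every point of `{x}ᶜ` has exactly one preimage. [folklore] -/
theorem existsUnique_preimage_of_isIso_restrict_compl [IsIso (f ∣_ (⟨{x}ᶜ, hx.isOpen_compl⟩ : F₁.Opens))] (x' : F₁) (hx' : x' ≠ x) :
    ∃! y : F₉, f y = x' := by
  set U : F₁.Opens := ⟨{x}ᶜ, hx.isOpen_compl⟩ with hU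
  have hbij := ConcreteCategory.bijective_of_isIso (f ∣_ U).base
  have hx'U : x' ∈ U := hx'
  obtain ⟨y', hy'⟩ := hbij.2 ⟨x', hx'U⟩
  refine ⟨y'.1, ?_, ?_⟩
  · have := congrArg Subtype.val hy'
    simpa [morphismRestrict_base_coe] using this
  · intro y hy
    have hyU : f y ∈ U := by rw [hy]; exact hx'U
    have : (f ∣_ U).base ⟨y, hyU⟩ = (f ∣_ U).base y' := by
      rw [hy']
      apply Subtype.ext
      simp [morphismRestrict_base_coe, hy]
    exact congrArg Subtype.val (hbij.1 this)

/-- Off the point: `closure T₁ ∩ {x}ᶜ = T₁ ∩ {x}ᶜ` when `T₉` is closed and `T₉ ∩ f⁻¹{x}ᶜ = f⁻¹(T₁ ∖ {x})` for a morphism that is an isomorphism over `{x}ᶜ`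
(the image of the closed `T₉ ∩ f⁻¹{x}ᶜ` under the homeomorphism onto `{x}ᶜ`). [folklore] -/
theorem mem_of_mem_closure_of_ne [IsIso (f ∣_ (⟨{x}ᶜ, hx.isOpen_compl⟩ : F₁.Opens))] (T₁ : Set F₁) (T₉ : Set F₉) (hT₉ : IsClosed T₉)
    (hbook : T₉ ∩ f ⁻¹' {x}ᶜ = f ⁻¹' (T₁ \ {x})) {p : F₁} (hp : p ∈ closure T₁) (hpx : p ≠ x) : p ∈ T₁ := by
  set U : F₁.Opens := ⟨{x}ᶜ, hx.isOpen_compl⟩ with hU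
  by_contra hpT
  obtain ⟨y₀, hy₀, -⟩ := existsUnique_preimage_of_isIso_restrict_compl f x hx p hpx
  have hy₀T : y₀ ∉ T₉ := by
    intro h
    have : y₀ ∈ T₉ ∩ f ⁻¹' {x}ᶜ := ⟨h, by simpa [hy₀] using hpx⟩
    rw [hbook] at this
    exact hpT (by simpa [hy₀] using this.1)
  -- the open immersion `f⁻¹U ↪ F₉ → F₁`
  haveI : IsOpenImmersion ((f ⁻¹ᵁ U).ι ≫ f) := by rw [← morphismRestrict_ι]; infer_instance
  have hopen : IsOpenMap ((f ⁻¹ᵁ U).ι ≫ f).base := ((f ⁻¹ᵁ U).ι ≫ f).isOpenEmbedding.isOpenMap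
  have hy₀U : y₀ ∈ f ⁻¹ᵁ U := by show f y₀ ∈ U; rw [hy₀]; exact hpx
  -- an open neighbourhood of `y₀` missing `T₉`, read in `f⁻¹U`, maps to an open neighbourhood of `p` missing `T₁`
  let N : Set ↥(f ⁻¹ᵁ U) := (f ⁻¹ᵁ U).ι ⁻¹' T₉ᶜ
  have hN : IsOpen N := hT₉.isOpen_compl.preimage (f ⁻¹ᵁ U).ι.continuous
  have hO : IsOpen (((f ⁻¹ᵁ U).ι ≫ f).base '' N) := hopen N hN
  have hpO : p ∈ ((f ⁻¹ᵁ U).ι ≫ f).base '' N := by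
    refine ⟨⟨y₀, hy₀U⟩, ?_, ?_⟩
    · show (f ⁻¹ᵁ U).ι ⟨y₀, hy₀U⟩ ∈ T₉ᶜ
      rw [Scheme.Opens.ι_apply]; exact hy₀T
    · show ((f ⁻¹ᵁ U).ι ≫ f) ⟨y₀, hy₀U⟩ = p
      rw [Scheme.Hom.comp_apply, Scheme.Opens.ι_apply]; exact hy₀
  -- `p ∈ closure T₁` meets that neighbourhood
  obtain ⟨q, hqO, hqT⟩ := mem_closure_iff.mp hp _ hO hpO
  obtain ⟨y₁, hy₁N, hy₁q⟩ := hqO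
  have hfy₁ : f y₁.1 = q := by
    rw [← hy₁q, Scheme.Hom.comp_apply, Scheme.Opens.ι_apply]
  have hy₁x : f y₁.1 ≠ x := fun h => (show f y₁.1 ∈ U from y₁.2) h
  have hmem : y₁.1 ∈ f ⁻¹' (T₁ \ {x}) := by
    show f y₁.1 ∈ T₁ \ {x}
    rw [hfy₁]; exact ⟨hqT, by rw [← hfy₁]; exact hy₁x⟩
  rw [← hbook] at hmem
  exact hy₁N (show (f ⁻¹ᵁ U).ι y₁ ∈ T₉ by rw [Scheme.Opens.ι_apply]; exact hmem.1)

/-- Off the point: the stalks of the reduced-closure ideals of `T₉` and `T₁` correspond under the stalk isomorphisms of `f`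
(`comap_vanishingIdeal_of_isOpenImmersion` on the open immersion `f⁻¹{x}ᶜ ↪ F₉ → F₁`, `stalkIdeal_comap_eq_map`). [folklore] -/
theorem stalkIdeal_vanishingIdeal_closure_eq_map [IsIso (f ∣_ (⟨{x}ᶜ, hx.isOpen_compl⟩ : F₁.Opens))] (T₁ : Set F₁) (T₉ : Set F₉) (hT₉ : IsClosed T₉)
    (hbook : T₉ ∩ f ⁻¹' {x}ᶜ = f ⁻¹' (T₁ \ {x})) (y : F₉) (hy : f y ≠ x) :
    stalkIdeal (vanishingIdeal (⟨closure T₉, isClosed_closure⟩ : Closeds F₉)) y =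
      (stalkIdeal (vanishingIdeal (⟨closure T₁, isClosed_closure⟩ : Closeds F₁)) (f y)).map (f.stalkMap y).hom := by
  set U : F₁.Opens := ⟨{x}ᶜ, hx.isOpen_compl⟩ with hU
  haveI : IsOpenImmersion ((f ⁻¹ᵁ U).ι ≫ f) := by rw [← morphismRestrict_ι]; infer_instance
  have key : (vanishingIdeal (⟨closure T₉, isClosed_closure⟩ : Closeds F₉)).comap (f ⁻¹ᵁ U).ι =
      ((vanishingIdeal (⟨closure T₁, isClosed_closure⟩ : Closeds F₁)).comap f).comap (f ⁻¹ᵁ U).ι := by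
    rw [← Scheme.IdealSheafData.comap_comp, comap_vanishingIdeal_of_isOpenImmersion,
      comap_vanishingIdeal_of_isOpenImmersion]
    congr 1
    apply TopologicalSpace.Closeds.ext
    ext y'
    simp only [TopologicalSpace.Closeds.coe_preimage, Set.mem_preimage, TopologicalSpace.Closeds.coe_mk, hT₉.closure_eq]
    have hy'x : f ((f ⁻¹ᵁ U).ι y') ≠ x := by
      rw [Scheme.Opens.ι_apply]; exact fun h => (show f y'.1 ∈ U from y'.2) h
    rw [Scheme.Hom.comp_apply]
    constructor
    · intro h
      have : (f ⁻¹ᵁ U).ι y' ∈ T₉ ∩ f ⁻¹' {x}ᶜ := ⟨h, hy'x⟩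
      rw [hbook] at this
      exact subset_closure this.1
    · intro h
      have hT : f ((f ⁻¹ᵁ U).ι y') ∈ T₁ := mem_of_mem_closure_of_ne f x hx T₁ T₉ hT₉ hbook h hy'x
      have : (f ⁻¹ᵁ U).ι y' ∈ f ⁻¹' (T₁ \ {x}) := ⟨hT, hy'x⟩
      rw [← hbook] at this
      exact this.1
  have hyU : y ∈ f ⁻¹ᵁ U := hy
  have h := (stalkIdeal_comap_eq_iff_of_isIso_stalkMap (f ⁻¹ᵁ U).ι
    (vanishingIdeal (⟨closure T₉, isClosed_closure⟩ : Closeds F₉))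
    ((vanishingIdeal (⟨closure T₁, isClosed_closure⟩ : Closeds F₁)).comap f) ⟨y, hyU⟩).mp (by rw [key])
  rw [Scheme.Opens.ι_apply] at h
  rw [h, stalkIdeal_comap_eq_map]

/-- Off the point: regularity of the reduced closure of `T₉` at a point over `y` with `f y ≠ x` is regularity of the reduced closure of `T₁` at the point over
`f y` (`isRegularLocalRing_stalk_subscheme_iff` on both floors + the quotient isomorphism along the stalk isomorphism of `f`). [folklore] -/
theorem isRegularLocalRing_subscheme_stalk_iff_of_isIso_restrict_compl [IsIso (f ∣_ (⟨{x}ᶜ, hx.isOpen_compl⟩ : F₁.Opens))] (T₁ : Set F₁) (T₉ : Set F₉)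
    (hT₉ : IsClosed T₉) (hbook : T₉ ∩ f ⁻¹' {x}ᶜ = f ⁻¹' (T₁ \ {x})) (y : F₉) (hy : f y ≠ x)
    (z₉ : ↥(vanishingIdeal (⟨closure T₉, isClosed_closure⟩ : Closeds F₉)).subscheme)
    (hz₉ : ((vanishingIdeal (⟨closure T₉, isClosed_closure⟩ : Closeds F₉)).subschemeι z₉ : F₉) = y)
    (z : ↥(vanishingIdeal (⟨closure T₁, isClosed_closure⟩ : Closeds F₁)).subscheme)
    (hz : ((vanishingIdeal (⟨closure T₁, isClosed_closure⟩ : Closeds F₁)).subschemeι z : F₁) = f y) :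
    IsRegularLocalRing ((vanishingIdeal (⟨closure T₉, isClosed_closure⟩ : Closeds F₉)).subscheme.presheaf.stalk z₉) ↔
      IsRegularLocalRing ((vanishingIdeal (⟨closure T₁, isClosed_closure⟩ : Closeds F₁)).subscheme.presheaf.stalk z) := by
  rw [isRegularLocalRing_stalk_subscheme_iff, isRegularLocalRing_stalk_subscheme_iff]
  have hz₉' : (vanishingIdeal (⟨closure T₉, isClosed_closure⟩ : Closeds F₉)).subschemeι.base z₉ = y := hz₉
  have hz' : (vanishingIdeal (⟨closure T₁, isClosed_closure⟩ : Closeds F₁)).subschemeι.base z = f y := hz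
  rw [hz₉', hz']
  haveI : IsIso (f.stalkMap y) := isIso_stalkMap_of_isIso_restrict_compl f x hx y hy
  let e : F₁.presheaf.stalk (f y) ≃+* F₉.presheaf.stalk y := (asIso (f.stalkMap y)).commRingCatIsoToRingEquiv
  have he : (e : F₁.presheaf.stalk (f y) →+* F₉.presheaf.stalk y) = (f.stalkMap y).hom := rfl
  have hmap : stalkIdeal (vanishingIdeal (⟨closure T₉, isClosed_closure⟩ : Closeds F₉)) y =
      (stalkIdeal (vanishingIdeal (⟨closure T₁, isClosed_closure⟩ : Closeds F₁)) (f y)).map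
        (e : F₁.presheaf.stalk (f y) →+* F₉.presheaf.stalk y) := by
    rw [he]; exact stalkIdeal_vanishingIdeal_closure_eq_map f x hx T₁ T₉ hT₉ hbook y hy
  let q := Ideal.quotientEquiv _ _ e hmap
  exact ⟨fun h => IsRegularLocalRing.of_ringEquiv q.symm, fun h => IsRegularLocalRing.of_ringEquiv q⟩

/-- Naturality of `baseToStalk`: the structure map `k → 𝒪_{F₉,y}` of `f ≫ ρ` is the structure map `k → 𝒪_{F₁,f y}` of `ρ` followed by the stalk map of
`f` (`germ_stalkMap`). [OURS · plumbing] -/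
theorem baseToStalk_comp {n : ℕ} {k : Type} [Field k] (ρ : F₁ ⟶ (Literature.AlgebraicGeometry.Motives.projectiveSpace n k).left) (y : F₉) :
    baseToStalk n k (f ≫ ρ) y = (f.stalkMap y).hom.comp (baseToStalk n k ρ (f y)) := by
  apply RingHom.ext
  intro a
  simp only [baseToStalk, RingHom.coe_comp, Function.comp_apply, Category.assoc, Scheme.Hom.comp_appTop]
  rw [Scheme.Hom.germ_stalkMap_apply f ⊤ y trivial]
  rfl

/-- Off the point: local ND frame data move along `f` (frame pulled back by `comap`, generators and the ND polynomial through the stalk isomorphism).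
[OURS · (B4β′) transport] -/
theorem isNDFrameAt_comap_of_isIso_restrict_compl {n : ℕ} {k : Type} [Field k] [IsIso (f ∣_ (⟨{x}ᶜ, hx.isOpen_compl⟩ : F₁.Opens))]
    (ρ : F₁ ⟶ (Literature.AlgebraicGeometry.Motives.projectiveSpace n k).left) (T₁ : Set F₁) (T₉ : Set F₉) (hT₉ : IsClosed T₉)
    (hbook : T₉ ∩ f ⁻¹' {x}ᶜ = f ⁻¹' (T₁ \ {x})) (y : F₉) (hy : f y ≠ x) (W : Fin n → F₁.IdealSheafData)
    (hW : IsNDFrameAt n k ρ T₁ W (f y)) : IsNDFrameAt n k (f ≫ ρ) T₉ (fun j => (W j).comap f) y := by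
  obtain ⟨w, g, h1, h2, h3, h4, h5⟩ := hW
  haveI : IsIso (f.stalkMap y) := isIso_stalkMap_of_isIso_restrict_compl f x hx y hy
  let e : F₁.presheaf.stalk (f y) ≃+* F₉.presheaf.stalk y := (asIso (f.stalkMap y)).commRingCatIsoToRingEquiv
  have he : (e : F₁.presheaf.stalk (f y) →+* F₉.presheaf.stalk y) = (f.stalkMap y).hom := rfl
  refine ⟨fun j => e (w j), g, fun j => ?_, ?_, ?_, h4, ?_⟩
  · rw [stalkIdeal_comap_eq_map, h1 j, ← he, Ideal.map_span, Set.image_singleton]; rfl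
  · have : Set.range (fun j => e (w j)) = e '' Set.range w := by
      ext t; simp [Set.mem_range, Set.mem_image]
    rw [this, ← Ideal.map_span, h2]
    exact IsLocalRing.map_ringEquiv_maximalIdeal e
  · rw [← ringKrullDim_eq_of_ringEquiv e, h3]
  · rw [stalkIdeal_vanishingIdeal_closure_eq_map f x hx T₁ T₉ hT₉ hbook y hy, h5, Ideal.map_span, Set.image_singleton,
      MvPolynomial.eval₂_comp_left, ← baseToStalk_comp f ρ y]
    rfl

/-- Points of the reduced closure of `T`, read in the ambient scheme, are the points of `closure T`. [folklore] -/
theorem range_subschemeι_vanishingIdeal_closure {F : Scheme.{0}} (T : Set F) :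
    Set.range (vanishingIdeal (⟨closure T, isClosed_closure⟩ : Closeds F)).subschemeι.base = closure T := by
  have h := Scheme.IdealSheafData.range_subschemeι (vanishingIdeal (⟨closure T, isClosed_closure⟩ : Closeds F))
  rw [Scheme.IdealSheafData.coe_support_vanishingIdeal] at h
  exact h

end Persist

section Main

/-- **(B4β′) `ndInvPersists : NDInvPersists n k`** — the downstairs invariant `NDInv` PERSISTS through one round: off the blown-up point `x` the round
`β ≫ υ` is an isomorphism onto `{x}ᶜ`, so the other non-regular points of the reduced closure and their local ND frame data move along it
(`isNDFrameAt_comap_of_isIso_restrict_compl`, `isRegularLocalRing_subscheme_stalk_iff_of_isIso_restrict_compl`); over `x` the END clause makes every point of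
the new reduced closure regular; hence the non-regular set drops from `m + 1` points to `m`. [OURS · L1 W4.5b · desk R31 (β) brick (B4β′); PROVED] -/
theorem ndInvPersists (n : ℕ) (k : Type) [Field k] : NDInvPersists n k := by
  classical
  intro m F₁ ρ T₁ hND x hx hxz F₂ υ hυ F₉ β T₉ hreg₉ hT₉ hend hiso hbook
  obtain ⟨_, S, hcard, hiff, hS⟩ := hND
  obtain ⟨z₀, hz₀x, hz₀⟩ := hxz
  have hxS : x ∈ S := by
    by_contra h
    exact hz₀ ((hiff z₀).mpr (by rw [hz₀x]; exact h))
  haveI := hiso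
  -- unique preimages off `x`
  have hpre : ∀ x' ∈ S.erase x, ∃! y : F₉, (β ≫ υ) y = x' := fun x' hx' =>
    existsUnique_preimage_of_isIso_restrict_compl (β ≫ υ) x hx x' (Finset.ne_of_mem_erase hx')
  let φ : ↥(S.erase x) → F₉ := fun p => (hpre p.1 p.2).choose
  have hφ : ∀ p : ↥(S.erase x), (β ≫ υ) (φ p) = p.1 := fun p => (hpre p.1 p.2).choose_spec.1
  have hφuniq : ∀ (p : ↥(S.erase x)) (y : F₉), (β ≫ υ) y = p.1 → y = φ p := fun p y hy =>
    (hpre p.1 p.2).unique hy (hφ p)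
  have hφinj : Function.Injective φ := by
    intro p q h
    apply Subtype.ext
    rw [← hφ p, ← hφ q, h]
  let S₉ : Finset F₉ := (S.erase x).attach.image φ
  have hmem : ∀ y : F₉, y ∈ S₉ ↔ (β ≫ υ) y ≠ x ∧ (β ≫ υ) y ∈ S := by
    intro y
    constructor
    · intro hy
      obtain ⟨p, -, rfl⟩ := Finset.mem_image.mp hy
      rw [hφ p]
      exact ⟨Finset.ne_of_mem_erase p.2, Finset.mem_of_mem_erase p.2⟩
    · rintro ⟨hyx, hyS⟩
      have hp : (β ≫ υ) y ∈ S.erase x := Finset.mem_erase.mpr ⟨hyx, hyS⟩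
      have : y = φ ⟨_, hp⟩ := hφuniq ⟨_, hp⟩ y rfl
      rw [this]
      exact Finset.mem_image.mpr ⟨⟨_, hp⟩, Finset.mem_attach _ _, rfl⟩
  refine ⟨hreg₉, S₉, ?_, ?_, ?_⟩
  · -- the count drops by one
    rw [Finset.card_image_of_injective _ hφinj, Finset.card_attach, Finset.card_erase_of_mem hxS, hcard]
    rfl
  · -- regular ⟺ not recorded
    intro z₉
    by_cases hyx : (β ≫ υ) ((vanishingIdeal (⟨closure T₉, isClosed_closure⟩ : Closeds F₉)).subschemeι z₉) = x
    · refine iff_of_true (hend z₉ hyx) ?_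
      intro h
      exact ((hmem _).mp h).1 hyx
    · -- off `x`: the point comes from a point of the reduced closure of `T₁`
      have hyT₉ : ((vanishingIdeal (⟨closure T₉, isClosed_closure⟩ : Closeds F₉)).subschemeι z₉ : F₉) ∈ closure T₉ :=
        (Set.ext_iff.mp (range_subschemeι_vanishingIdeal_closure T₉) _).mp ⟨z₉, rfl⟩
      have hyT₉' := hT₉.closure_subset hyT₉
      have hfy : (β ≫ υ) ((vanishingIdeal (⟨closure T₉, isClosed_closure⟩ : Closeds F₉)).subschemeι z₉) ∈ T₁ \ {x} := by
        have : ((vanishingIdeal (⟨closure T₉, isClosed_closure⟩ : Closeds F₉)).subschemeι z₉ : F₉) ∈ T₉ ∩ (β ≫ υ) ⁻¹' {x}ᶜ := ⟨hyT₉', hyx⟩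
        rwa [hbook] at this
      obtain ⟨z, hz⟩ : ∃ z : ↥(vanishingIdeal (⟨closure T₁, isClosed_closure⟩ : Closeds F₁)).subscheme,
          (vanishingIdeal (⟨closure T₁, isClosed_closure⟩ : Closeds F₁)).subschemeι.base z =
            (β ≫ υ) ((vanishingIdeal (⟨closure T₉, isClosed_closure⟩ : Closeds F₉)).subschemeι z₉) := by
        have : (β ≫ υ) ((vanishingIdeal (⟨closure T₉, isClosed_closure⟩ : Closeds F₉)).subschemeι z₉) ∈
            Set.range (vanishingIdeal (⟨closure T₁, isClosed_closure⟩ : Closeds F₁)).subschemeι.base := by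
          rw [range_subschemeι_vanishingIdeal_closure T₁]; exact subset_closure hfy.1
        exact this
      rw [isRegularLocalRing_subscheme_stalk_iff_of_isIso_restrict_compl (β ≫ υ) x hx T₁ T₉ hT₉ hbook _ hyx z₉ rfl z hz, hiff z,
        hmem]
      push Not
      constructor
      · intro h _; rw [← hz]; exact h
      · intro h; rw [hz] at *; exact h hyx
  · -- the recorded points: over the old ones, closed, with transported ND frame data
    intro y₉ hy₉
    obtain ⟨hyx, hyS⟩ := (hmem y₉).mp hy₉
    obtain ⟨⟨z, hz⟩, hx'cl, W, hW⟩ := hS _ hyS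
    -- the old point lies in `T₁` (it is in the closure and is not `x`)
    have hx'T : (β ≫ υ) y₉ ∈ T₁ := by
      have hcl : (β ≫ υ) y₉ ∈ closure T₁ := by
        rw [← range_subschemeι_vanishingIdeal_closure T₁]; exact ⟨z, hz⟩
      exact mem_of_mem_closure_of_ne (β ≫ υ) x hx T₁ T₉ hT₉ hbook hcl hyx
    have hyT₉ : y₉ ∈ T₉ := by
      have : y₉ ∈ (β ≫ υ) ⁻¹' (T₁ \ {x}) := ⟨hx'T, hyx⟩
      rw [← hbook] at this
      exact this.1
    refine ⟨?_, ?_, fun j => (W j).comap (β ≫ υ), isNDFrameAt_comap_of_isIso_restrict_compl (β ≫ υ) x hx ρ T₁ T₉ hT₉ hbook y₉ hyx W hW⟩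
    · have : y₉ ∈ Set.range (vanishingIdeal (⟨closure T₉, isClosed_closure⟩ : Closeds F₉)).subschemeι.base := by
        rw [range_subschemeι_vanishingIdeal_closure T₉]; exact subset_closure hyT₉
      obtain ⟨z₉, hz₉⟩ := this
      exact ⟨z₉, hz₉⟩
    · -- `{y₉} = (β ≫ υ)⁻¹ {x'}` is closed
      have : ({y₉} : Set F₉) = (β ≫ υ) ⁻¹' {(β ≫ υ) y₉} := by
        ext y
        simp only [Set.mem_singleton_iff, Set.mem_preimage]
        constructor
        · rintro rfl; rfl
        · intro hy
          have hp : (β ≫ υ) y₉ ∈ S.erase x := Finset.mem_erase.mpr ⟨hyx, hyS⟩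
          exact (hφuniq ⟨_, hp⟩ y hy).trans (hφuniq ⟨_, hp⟩ y₉ rfl).symm
      rw [this]
      exact hx'cl.preimage (β ≫ υ).continuous

end Main


end Summit.ResolutionOfSingularities.ResolutionOfSingularities.Cruxes.EquisingularLiftNat.Sections.ND

end
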